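import Mathlib
import HarnessLib

/-!
# `OneFlightGossipEngine.OneFlightLayeredChaos` — event form versus `L¹(condExp)` form of a defect
(crux stmt-AtomisticToContinuum-14535, helper for every line)

The crux bounds `|P(W ∩ A ∩ E) − u·P(W ∩ E)|` over all events `E` of a sub-σ-algebra `𝒢`, i.e. `|∫_E f dP|` for
`f = 1_{W∩A} − u 1_W`. The idea cards work instead with the conditional expectation `P[f | 𝒢]` (Bayes / Palm
inversion, marking). The two forms are equivalent up to a factor `2`:
`sup_{E ∈ 𝒢} |∫_E f| ≤ ∫ |P[f|𝒢]| ≤ 2 sup_{E ∈ 𝒢} |∫_E f|` — the generic measure-theoretic facts below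
(`setIntegral_condExp` plus the sign split `E₊ = {P[f|𝒢] ≥ 0} ∈ 𝒢`).
-/

open MeasureTheory Set Filter

namespace Summit.AtomisticToContinuum.HydrodynamicLimit.Theorems

/-- **Events ⇒ L¹.** If `|∫_E f dμ| ≤ δ` for every `m`-measurable event `E` (`m ≤ m0` a sub-σ-algebra, `μ` finite,
`f` integrable), then `∫ |μ[f|m]| dμ ≤ 2δ`: split along the `m`-measurable event `{μ[f|m] ≥ 0}` and use
`∫_E μ[f|m] = ∫_E f`. [folklore] -/
theorem integral_abs_condExp_le_of_setIntegral_le : ∀ {Ω : Type*} {m m0 : MeasurableSpace Ω} {μ : MeasureTheory.Measure Ω}, m ≤ m0 → ∀ [MeasureTheory.IsFiniteMeasure μ] {f : Ω → ℝ}, MeasureTheory.Integrable f μ → ∀ {δ : ℝ}, (∀ E : Set Ω, MeasurableSet[m] E → |∫ x in E, f x ∂μ| ≤ δ) → ∫ x, |MeasureTheory.condExp m μ f x| ∂μ ≤ 2 * δ := by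
  intro Ω m m0 μ hm _ f hf δ h
  set g : Ω → ℝ := μ[f|m] with hg
  have hgm : StronglyMeasurable[m] g := stronglyMeasurable_condExp
  have hEm : MeasurableSet[m] {x | 0 ≤ g x} := hgm.measurable measurableSet_Ici
  have hE : MeasurableSet {x | 0 ≤ g x} := hm _ hEm
  have hgi : Integrable g μ := integrable_condExp
  have hsplit : ∫ x, |g x| ∂μ = ∫ x in {x | 0 ≤ g x}, |g x| ∂μ + ∫ x in {x | 0 ≤ g x}ᶜ, |g x| ∂μ :=
    (integral_add_compl hE hgi.abs).symm
  have h1 : ∫ x in {x | 0 ≤ g x}, |g x| ∂μ = ∫ x in {x | 0 ≤ g x}, g x ∂μ :=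
    setIntegral_congr_fun hE fun x hx => abs_of_nonneg hx
  have h2 : ∫ x in {x | 0 ≤ g x}ᶜ, |g x| ∂μ = -∫ x in {x | 0 ≤ g x}ᶜ, g x ∂μ := by
    rw [← integral_neg]
    refine setIntegral_congr_fun hE.compl fun x hx => ?_
    exact abs_of_neg (lt_of_not_ge hx)
  have h3 : ∫ x in {x | 0 ≤ g x}, g x ∂μ = ∫ x in {x | 0 ≤ g x}, f x ∂μ :=
    setIntegral_condExp hm hf hEm
  have h4 : ∫ x in {x | 0 ≤ g x}ᶜ, g x ∂μ = ∫ x in {x | 0 ≤ g x}ᶜ, f x ∂μ :=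
    setIntegral_condExp hm hf hEm.compl
  calc ∫ x, |g x| ∂μ
      = ∫ x in {x | 0 ≤ g x}, |g x| ∂μ + ∫ x in {x | 0 ≤ g x}ᶜ, |g x| ∂μ := hsplit
    _ = ∫ x in {x | 0 ≤ g x}, f x ∂μ + -∫ x in {x | 0 ≤ g x}ᶜ, f x ∂μ := by rw [h1, h2, h3, h4]
    _ ≤ δ + δ := add_le_add (le_of_abs_le (h _ hEm)) ((neg_le_abs _).trans (h _ hEm.compl))
    _ = 2 * δ := by ring

/-- **L¹ ⇒ events.** For every `m`-measurable event `E`: `|∫_E f dμ| ≤ ∫ |μ[f|m]| dμ`. [folklore] -/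
theorem abs_setIntegral_le_integral_abs_condExp : ∀ {Ω : Type*} {m m0 : MeasurableSpace Ω} {μ : MeasureTheory.Measure Ω}, m ≤ m0 → ∀ [MeasureTheory.IsFiniteMeasure μ] {f : Ω → ℝ}, MeasureTheory.Integrable f μ → ∀ {E : Set Ω}, MeasurableSet[m] E → |∫ x in E, f x ∂μ| ≤ ∫ x, |MeasureTheory.condExp m μ f x| ∂μ := by
  intro Ω m m0 μ hm _ f hf E hE
  rw [← setIntegral_condExp hm hf hE]
  calc |∫ x in E, (μ[f|m]) x ∂μ| ≤ ∫ x in E, |(μ[f|m]) x| ∂μ := abs_integral_le_integral_abs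
    _ ≤ ∫ x, |(μ[f|m]) x| ∂μ :=
        setIntegral_le_integral integrable_condExp.abs (Eventually.of_forall fun x => abs_nonneg _)

/-- **The crux's defect is a set integral.** For measurable `W, A`, ANY set `E` (measurable or not — the set
integral is over `μ.restrict E`, and `μ (· ∩ E)` is then the outer measure, exactly as in the crux) and real `u`:
`μ(W ∩ A ∩ E) − u·μ(W ∩ E) = ∫_E (1_{W∩A} − u·1_W) dμ` (finite `μ`). With the two lemmas above this turns the
crux's `∀ E ∈ 𝒢` form into an `L¹` bound on `μ[1_{W∩A} − u 1_W | 𝒢]` and back (once `𝒢 ≤` the ambient σ-algebra,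
i.e. after the flow-junk null modification). [folklore] -/
theorem measureReal_inter_sub_mul_eq_setIntegral : ∀ {Ω : Type*} {m0 : MeasurableSpace Ω} {μ : MeasureTheory.Measure Ω} [MeasureTheory.IsFiniteMeasure μ] {W A : Set Ω} (E : Set Ω), MeasurableSet W → MeasurableSet A → ∀ u : ℝ, (μ (W ∩ A ∩ E)).toReal - u * (μ (W ∩ E)).toReal = ∫ x in E, ((W ∩ A).indicator (fun _ => (1 : ℝ)) x - u * W.indicator (fun _ => (1 : ℝ)) x) ∂μ := by
  intro Ω m0 μ _ W A E hW hA u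
  have hWA : MeasurableSet (W ∩ A) := hW.inter hA
  have i1 : Integrable ((W ∩ A).indicator fun _ => (1 : ℝ)) (μ.restrict E) :=
    (integrable_const (1 : ℝ)).indicator hWA
  have i2 : Integrable (fun x => u * W.indicator (fun _ => (1 : ℝ)) x) (μ.restrict E) :=
    ((integrable_const (1 : ℝ)).indicator hW).const_mul u
  rw [integral_sub i1 i2, integral_const_mul, integral_indicator hWA, integral_indicator hW,
    setIntegral_const, setIntegral_const, measureReal_restrict_apply hWA, measureReal_restrict_apply hW,
    smul_eq_mul, smul_eq_mul, mul_one, mul_one, measureReal_def, measureReal_def]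

end Summit.AtomisticToContinuum.HydrodynamicLimit.Theorems
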